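import Literature.Barriers.AtomisticToContinuum.DisorderedHarmonicChainApproxKernelsFactors
import Literature.Barriers.AtomisticToContinuum.DisorderedHarmonicChainPhaseCalculus
import Mathlib.MeasureTheory.Integral.IntervalIntegral.FundThmCalculus
import Mathlib.Analysis.SpecialFunctions.Integrals.Basic
import HarnessLib

/-!
# Ajanki–Huveneers 2011, App. 7.3: decay and strict bounds on the good multipliers `λ(y', ξ)`

Fourth support file of the provefact unit for `AjankiHuveneers2011_approxKernels` (Lemma 5.2 of
O. Ajanki, F. Huveneers, CMP **301** (2011) 841–883, arXiv:1003.1076). Continues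
`DisorderedHarmonicChainApproxKernelsFactors.lean` with the two bounds that hold for GOOD
frozen points `y'` (`sin²(πy') ≥ α₀`), which the paper uses for `|ξw| ≥ ε'` ("(Pn grand)"):

* `norm_integral_cexp_mul_deriv_mul_le`: the integration-by-parts bound
  `|∫ₐᵇ e^{iκφ} φ' g| ≤ (2‖g‖_∞ + (b-a)‖g'‖_∞)/|κ|` for `g` continuous on `[a,b]`, `C¹` inside
  (fundamental theorem of calculus in the form `integral_eq_sub_of_hasDerivAt_of_le`, which matches
  exactly the regularity `τ ∈ C([b₋,b₊]) ∩ C¹(]b₋,b₊[)` of the reduced law);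
* `norm_ahLam_le_div`: `|λ(y', ξ)| ≤ C₃/(|ξ|w)` for `ξ ≠ 0` — the paper's "`|∂ˡ_zλ_k(z)| ≤ C/z` …
  one checks from the definition of `Φ` that `|∂_bμ(b)| ≳ 1`", here with `∂_b c = ∂_b f_b(y')`
  from `DisorderedHarmonicChainPhaseCalculus.hasDerivAt_ahStep_b` (`≥ w sin²(πy')/2`) and the
  amplitude `ω/∂_bc`, `1/∂_bc = πP/(2c(w)sin²πy')` being a quadratic polynomial in `b`;
* `norm_charfun_tau_le`: the characteristic function of `τ` is `≤ 1 - ε₂L'x²/9 < 1` away from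
  `0` (`τ ≥ ε₂` on a window; `|∫_J e^{itb}db| = L'|sin x|/x`, `sin x ≤ x - x³/9` on `[0,1]`) —
  the paper's "`|∫_J e^{izα_kb}τ(b)db| ≤ (1 - ε₃)∫_Jτ`" made quantitative and uniform;
* `norm_ahLam_le_strict`: for `sin²(πy') ≥ α₀` and `|ξ|w ≥ ε`, `|λ(y', ξ)| ≤ A' < 1` for small `w`
  (decay bound beyond `2C₃`, strict bound plus the `𝒪(w)` perturbations on `[ε, 2C₃]`).

No named facts are introduced.
-/

noncomputable section

open MeasureTheory Real Complex Set

namespace Literature.Barriers.AtomisticToContinuum.HeatConduction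

/-! ### An oscillatory integral bound by integration by parts -/

section Oscillatory

/-- **First-derivative (integration by parts) bound for an oscillatory integral.** For `κ ≠ 0`,
a phase `φ` differentiable on `[a, b]` and an amplitude `g` continuous on `[a, b]`, differentiable
inside with `|g| ≤ B_g`, `|g'| ≤ B_g'`:
`|∫ₐᵇ e^{iκφ(x)} φ'(x) g(x) dx| ≤ (2B_g + (b - a)B_g')/|κ|`
(`e^{iκφ}φ' = (e^{iκφ})'/(iκ)` and the fundamental theorem of calculus). This is the mechanism of
"`|∂ˡ_z λ_k(z)| ≤ C/z` … An integration by parts gives …" in App. 7.3. [folklore] -/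
theorem norm_integral_cexp_mul_deriv_mul_le {a b κ Bg Bg' : ℝ} (hab : a ≤ b) (hκ : κ ≠ 0)
    {φ φ' : ℝ → ℝ} {g g' : ℝ → ℂ} (hφ : ∀ x ∈ Icc a b, HasDerivAt φ (φ' x) x)
    (hφ'm : Measurable φ') {Bφ : ℝ} (hφ'b : ∀ x ∈ Icc a b, |φ' x| ≤ Bφ)
    (hg : ContinuousOn g (Icc a b)) (hgd : ∀ x ∈ Ioo a b, HasDerivAt g (g' x) x)
    (hgm : Measurable g) (hg'm : Measurable g') (hgb : ∀ x ∈ Icc a b, ‖g x‖ ≤ Bg)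
    (hg'b : ∀ x, ‖g' x‖ ≤ Bg') :
    ‖∫ x in a..b, cexp (I * κ * φ x) * (φ' x : ℂ) * g x‖ ≤ (2 * Bg + (b - a) * Bg') / |κ| := by
  have hκc : (κ : ℂ) ≠ 0 := by exact_mod_cast hκ
  have hκ' : (I * κ : ℂ) ≠ 0 := mul_ne_zero Complex.I_ne_zero hκc
  have hnIκ : ‖(I * κ : ℂ)‖ = |κ| := by rw [norm_mul, Complex.norm_I, one_mul, Complex.norm_real, Real.norm_eq_abs]
  have hBg : 0 ≤ Bg := (norm_nonneg _).trans (hgb a (left_mem_Icc.mpr hab))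
  have hBg' : 0 ≤ Bg' := (norm_nonneg _).trans (hg'b a)
  -- the primitive `F = e^{iκφ} g/(iκ)` and its derivative
  set F : ℝ → ℂ := fun x => cexp (I * κ * φ x) * g x / (I * κ) with hF
  set F' : ℝ → ℂ := fun x => cexp (I * κ * φ x) * (φ' x : ℂ) * g x + cexp (I * κ * φ x) * g' x / (I * κ)
    with hF'
  have hexp : ∀ x ∈ Icc a b, HasDerivAt (fun x => cexp (I * κ * φ x)) (cexp (I * κ * φ x) * (I * κ * φ' x)) x := by
    intro x hx
    have h1 : HasDerivAt (fun x => (I * κ * φ x : ℂ)) (I * κ * φ' x) x := by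
      have := ((hφ x hx).ofReal_comp).const_mul (I * κ)
      simpa using this
    exact h1.cexp
  have hFd : ∀ x ∈ Ioo a b, HasDerivAt F (F' x) x := by
    intro x hx
    have hxI : x ∈ Icc a b := Ioo_subset_Icc_self hx
    have h := ((hexp x hxI).mul (hgd x hx)).div_const (I * κ)
    refine h.congr_deriv ?_
    simp only [hF']
    field_simp
  have hφc : ContinuousOn φ (Icc a b) := fun x hx => (hφ x hx).continuousAt.continuousWithinAt
  have hFc : ContinuousOn F (Icc a b) := by
    simp only [hF]
    refine ContinuousOn.div_const (ContinuousOn.mul ?_ hg) _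
    exact Complex.continuous_exp.comp_continuousOn
      (continuousOn_const.mul (Complex.continuous_ofReal.comp_continuousOn hφc))
  -- bounds on `F` and on the remainder
  have hFb : ∀ x ∈ Icc a b, ‖F x‖ ≤ Bg / |κ| := fun x hx => by
    simp only [hF]
    rw [norm_div, norm_mul, hnIκ, show (I * κ * φ x : ℂ) = I * ((κ * φ x : ℝ) : ℂ) by push_cast; ring,
      Complex.norm_exp_I_mul_ofReal, one_mul]
    exact div_le_div_of_nonneg_right (hgb x hx) (abs_nonneg _)
  set G : ℝ → ℂ := fun x => cexp (I * κ * φ x) * g' x / (I * κ) with hG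
  have hGb : ∀ x, ‖G x‖ ≤ Bg' / |κ| := fun x => by
    simp only [hG]
    rw [norm_div, norm_mul, hnIκ, show (I * κ * φ x : ℂ) = I * ((κ * φ x : ℝ) : ℂ) by push_cast; ring,
      Complex.norm_exp_I_mul_ofReal, one_mul]
    exact div_le_div_of_nonneg_right (hg'b x) (abs_nonneg _)
  -- measurability / integrability
  have hφm' : AEStronglyMeasurable (fun x => cexp (I * κ * φ x)) (volume.restrict (Ioc a b)) := by
    have : AEStronglyMeasurable (fun x => cexp (I * κ * φ x)) (volume.restrict (Icc a b)) :=
      (Complex.continuous_exp.comp_continuousOn (continuousOn_const.mul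
        (Complex.continuous_ofReal.comp_continuousOn hφc))).aestronglyMeasurable measurableSet_Icc
    exact this.mono_measure (Measure.restrict_mono Ioc_subset_Icc_self le_rfl)
  have hGi : IntervalIntegrable G volume a b := by
    rw [intervalIntegrable_iff_integrableOn_Ioc_of_le hab]
    refine IntegrableOn.of_bound measure_Ioc_lt_top ?_ (Bg' / |κ|) (ae_of_all _ hGb)
    simp only [hG, div_eq_mul_inv]
    exact (hφm'.mul hg'm.aestronglyMeasurable).mul_const _
  have hMi : IntervalIntegrable (fun x => cexp (I * κ * φ x) * (φ' x : ℂ) * g x) volume a b := by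
    rw [intervalIntegrable_iff_integrableOn_Ioc_of_le hab]
    refine IntegrableOn.of_bound measure_Ioc_lt_top ?_ (1 * Bφ * Bg) ?_
    · exact (hφm'.mul (Complex.measurable_ofReal.comp hφ'm).aestronglyMeasurable).mul
        hgm.aestronglyMeasurable
    · rw [ae_restrict_iff' measurableSet_Ioc]
      refine ae_of_all _ fun x hx => ?_
      have hxI : x ∈ Icc a b := Ioc_subset_Icc_self hx
      rw [norm_mul, norm_mul, show (I * κ * φ x : ℂ) = I * ((κ * φ x : ℝ) : ℂ) by push_cast; ring,
        Complex.norm_exp_I_mul_ofReal, Complex.norm_real, Real.norm_eq_abs]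
      exact mul_le_mul (mul_le_mul_of_nonneg_left (hφ'b x hxI) zero_le_one) (hgb x hxI) (norm_nonneg _)
        (by have := (abs_nonneg _).trans (hφ'b x hxI); positivity)
  have hF'i : IntervalIntegrable F' volume a b := by
    have := hMi.add hGi
    exact this
  -- FTC and the identity `main = (F b - F a) - ∫ G`
  have hFTC := intervalIntegral.integral_eq_sub_of_hasDerivAt_of_le hab hFc hFd hF'i
  have hsplit : ∫ x in a..b, cexp (I * κ * φ x) * (φ' x : ℂ) * g x =
      (F b - F a) - ∫ x in a..b, G x := by
    rw [← hFTC, ← intervalIntegral.integral_sub hF'i hGi]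
    refine intervalIntegral.integral_congr fun x _ => ?_
    simp only [hF', hG]
    ring
  rw [hsplit]
  have haI : a ∈ Icc a b := left_mem_Icc.mpr hab
  have hbI : b ∈ Icc a b := right_mem_Icc.mpr hab
  calc ‖F b - F a - ∫ x in a..b, G x‖ ≤ ‖F b‖ + ‖F a‖ + ‖∫ x in a..b, G x‖ := by
        refine (norm_sub_le _ _).trans (add_le_add (norm_sub_le _ _) le_rfl)
    _ ≤ Bg / |κ| + Bg / |κ| + Bg' / |κ| * |b - a| := by
        refine add_le_add (add_le_add (hFb b hbI) (hFb a haI)) ?_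
        exact intervalIntegral.norm_integral_le_of_norm_le_const fun x _ => hGb x
    _ = (2 * Bg + (b - a) * Bg') / |κ| := by
        rw [abs_of_nonneg (sub_nonneg.mpr hab)]
        field_simp
        ring

end Oscillatory

/-! ### The oscillatory (integration-by-parts) bound on good factors -/

section Decay

variable {τ : ℝ → ℝ} {bm bp : ℝ} {w : ℝ} {h : ℝ → ℝ} {H : ℝ}

/-- `∂_b c(b) = ∂_b f_b(y') = c(w)(1 - cos 2πy')/(π P(y', δ(w,b)))`.
[cite: AjankiHuveneers2011, Lemma 3.2 eqs. (3.8), (3.11)] -/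
theorem hasDerivAt_ahC {w y' b : ℝ} (hw0 : 0 ≤ w) (hw : π * w / 2 < 1) (hδ : |igDelta w b| < 1) :
    HasDerivAt (ahC w y') (igC w * (1 - Real.cos (2 * π * y')) / (π * pcP y' (igDelta w b))) b := by
  have hd := hasDerivAt_ahStep_b (x := y') hw0 hw hδ
  have : ahC w y' = fun b => ahStep w b y' - (y' + w) := by
    funext b'; unfold ahC ahStep; ring
  rw [this]
  exact hd.sub_const (y' + w)
set_option maxHeartbeats 400000 in -- buildfix (bf3-g26): 160k/180k FAIL, 200k PASS at accept time; line-neutral budget line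
/-- **Decay of good factors**: if `φ(y') = sin²(πy') ≥ α₀ > 0` then `|λ(y', ξ)| ≤ C₃/(|ξ|w)` for
`ξ ≠ 0`, `w ≤ w₀`, with `C₃ = C₃(τ, ‖h‖_∞, α₀)` — the paper's "`|∂ˡ_zλ_k(z)| ≤ C/z` … for every
`k ∈ {k_j}`", here for `l = 0`: integrate by parts in `b`, using `∂_b c ≳ wα₀` (`ahStep_b_deriv_bounds`),
`1/∂_b c = πP/(2c(w) sin²πy')` quadratic in `b`, and `τ ∈ C¹` inside its support with bounded
derivative, continuous on the closed support. [cite: AjankiHuveneers2011, App. 7.3 (`interm lemm a`)] -/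
theorem norm_ahLam_le_div (hτ : ReducedLawHyp τ bm bp) (hH : ∀ z, |h z| ≤ H) {α₀ : ℝ} (hα₀ : 0 < α₀) :
    ∃ w₀ : ℝ, 0 < w₀ ∧ ∃ C₃ : ℝ, 0 < C₃ ∧ ∀ w ∈ Ioc 0 w₀, ∀ y' : ℝ, α₀ ≤ Real.sin (π * y') ^ 2 →
      ∀ ξ : ℤ, ξ ≠ 0 → ‖ahLam τ w h y' ξ‖ ≤ C₃ / (|(ξ : ℝ)| * w) := by
  obtain ⟨Cτ, hCτ0, hCτ⟩ := hτ.exists_bound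
  obtain ⟨Cd', hCd'⟩ := hτ.deriv_bound
  obtain ⟨Cd, hCd⟩ : ∃ Cd : ℝ, Cd = max Cd' 0 := ⟨_, rfl⟩
  have hCd0 : 0 ≤ Cd := hCd ▸ le_max_right _ _
  have hCdb : ∀ s ∈ Ioo bm bp, |deriv τ s| ≤ Cd := fun s hs => (hCd' s hs).trans (hCd ▸ le_max_left _ _)
  obtain ⟨M, hM⟩ : ∃ M : ℝ, M = max |bm| |bp| := ⟨_, rfl⟩
  have hM0 : 0 ≤ M := hM ▸ le_max_of_le_left (abs_nonneg _)
  have hH0 : 0 ≤ H := (abs_nonneg _).trans (hH 0)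
  have hL : 0 < bp - bm := sub_pos.mpr hτ.lt
  obtain ⟨K₀, hK₀⟩ : ∃ K₀ : ℝ, K₀ = 6 * Cτ + (bp - bm) * (2 * H * Cτ + 3 * Cd + 9 * π / 4 * Cτ) + 1 :=
    ⟨_, rfl⟩
  have hK₀0 : 0 < K₀ := by rw [hK₀]; positivity
  refine ⟨min (pcW M) (1 / (2 * H * M + 1)), lt_min (pcW_pos hM0) (by positivity), K₀ / (2 * π * α₀),
    by positivity, ?_⟩
  intro w hw y' hα ξ hξ
  obtain ⟨hw0, hwle⟩ := hw
  have hwpc : w ≤ pcW M := hwle.trans (min_le_left _ _)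
  have hw1 : w ≤ 1 := by
    refine hwpc.trans ?_
    unfold pcW
    rw [div_le_one (by positivity)]
    nlinarith [Real.pi_gt_three]
  have hwH : w * H * max |bm| |bp| ≤ 1 / 2 := by
    rw [← hM]
    have : w ≤ 1 / (2 * H * M + 1) := hwle.trans (min_le_right _ _)
    rw [le_div_iff₀ (by positivity)] at this
    nlinarith [mul_nonneg (mul_nonneg hw0.le hH0) hM0]
  have hbM : ∀ b ∈ Icc bm bp, |b| ≤ M := fun b hb => hM ▸ ReducedLawHyp.abs_le_of_mem hb
  have hsm : ∀ b ∈ Icc bm bp, π * w / 2 ≤ 1 / 2 ∧ π * w / 2 * (1 + |b|) < 1 ∧ |igDelta w b| ≤ 1 / 8 :=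
    fun b hb => pc_small hM0 hw0.le hwpc (hbM b hb)
  have hπw : π * w / 2 ≤ 1 / 2 := by
    have := pc_small hM0 hw0.le hwpc (show |(0:ℝ)| ≤ M by simpa using hM0); exact this.1
  have hπw1 : π * w / 2 < 1 := by linarith
  -- `S2 = 1 - cos 2πy' = 2 sin² πy' ≥ 2α₀`, `c(w) ≥ πw/2`
  obtain ⟨S2, hS2⟩ : ∃ S2 : ℝ, S2 = 1 - Real.cos (2 * π * y') := ⟨_, rfl⟩
  have hS2eq : S2 = 2 * Real.sin (π * y') ^ 2 := by
    rw [hS2, show 2 * π * y' = 2 * (π * y') by ring, Real.cos_two_mul, Real.cos_sq']; ring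
  have hS2pos : 0 < S2 := by rw [hS2eq]; linarith
  have hS2ge : 2 * α₀ ≤ S2 := by rw [hS2eq]; linarith
  have hcw : π * w / 2 ≤ igC w := le_igC hw0.le hπw1
  have hcw0 : 0 < igC w := lt_of_lt_of_le (by positivity) hcw
  have hcwS : 0 < igC w * S2 := mul_pos hcw0 hS2pos
  -- the amplitude `p = 1/∂_b c` and its derivative
  obtain ⟨p, hp⟩ : ∃ p : ℝ → ℝ, p = fun b => π * pcP y' (igDelta w b) / (igC w * S2) := ⟨_, rfl⟩
  obtain ⟨p', hp'⟩ : ∃ p' : ℝ → ℝ, p' = fun b => π * (pcPd y' (igDelta w b) * igC w) / (igC w * S2) :=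
    ⟨_, rfl⟩
  have hpd : ∀ b, HasDerivAt p (p' b) b := fun b => by
    rw [hp, hp']
    have h1 : HasDerivAt (fun b : ℝ => igC w * b) (igC w) b := by
      simpa using (hasDerivAt_id b).const_mul (igC w)
    have h2 : HasDerivAt (fun b : ℝ => pcP y' (igDelta w b)) (pcPd y' (igDelta w b) * igC w) b :=
      (hasDerivAt_pcP_delta y' (igDelta w b)).comp b h1
    exact (h2.const_mul π).div_const _
  have hpc : Continuous p := by
    rw [hp]; unfold pcP igDelta; fun_prop
  have hp'c : Continuous p' := by
    rw [hp']; unfold pcPd igDelta; fun_prop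
  -- bounds on `P`, `p`, `p'` on the support
  have hPb : ∀ b ∈ Icc bm bp, 1 / 2 ≤ pcP y' (igDelta w b) ∧ pcP y' (igDelta w b) ≤ 2 := fun b hb =>
    pcP_bounds ((hsm b hb).2.2.trans (by norm_num)) y'
  have hpb : ∀ b ∈ Icc bm bp, |p b| ≤ 2 / (α₀ * w) := fun b hb => by
    rw [hp]; dsimp only
    obtain ⟨-, hP2⟩ := hPb b hb
    rw [abs_of_nonneg (by have := (hPb b hb).1; positivity), div_le_div_iff₀ hcwS (by positivity)]
    calc π * pcP y' (igDelta w b) * (α₀ * w) ≤ π * 2 * (α₀ * w) := by gcongr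
      _ = 2 * ((π * w / 2) * (2 * α₀)) := by ring
      _ ≤ 2 * (igC w * S2) := by gcongr
  have hp'b : ∀ b ∈ Icc bm bp, |p' b| ≤ 3 * π / (2 * α₀) := fun b hb => by
    rw [hp']; dsimp only
    have hδ := (hsm b hb).2.2
    have hd : |pcPd y' (igDelta w b)| ≤ 3 := (abs_pcPd_le _ _).trans (by linarith)
    rw [show π * (pcPd y' (igDelta w b) * igC w) / (igC w * S2) = π * pcPd y' (igDelta w b) / S2 by
      field_simp, abs_div, abs_mul, abs_of_pos Real.pi_pos, abs_of_pos hS2pos,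
      div_le_div_iff₀ hS2pos (by positivity)]
    calc π * |pcPd y' (igDelta w b)| * (2 * α₀) ≤ π * 3 * (2 * α₀) := by gcongr
      _ = 3 * π * (2 * α₀) := by ring
      _ ≤ 3 * π * S2 := by gcongr
  -- the weight, its (modified) derivative, the amplitude `g = ω p`
  obtain ⟨τd, hτd⟩ : ∃ τd : ℝ → ℝ, τd = (Ioo bm bp).indicator (deriv τ) := ⟨_, rfl⟩
  have hτdm : Measurable τd := hτd ▸ (measurable_deriv τ).indicator measurableSet_Ioo
  have hτdb : ∀ b, |τd b| ≤ Cd := fun b => by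
    rw [hτd]
    by_cases hb : b ∈ Ioo bm bp
    · rw [indicator_of_mem hb]; exact hCdb b hb
    · rw [indicator_of_notMem hb, abs_zero]; exact hCd0
  obtain ⟨ωd, hωd⟩ : ∃ ωd : ℝ → ℝ, ωd = fun b => w * h y' * τ b + (1 + w * h y' * b) * τd b := ⟨_, rfl⟩
  have hωdm : Measurable ωd := by
    rw [hωd]
    exact (hτ.measurable.const_mul _).add ((measurable_const.add (measurable_const.mul measurable_id)).mul hτdm)
  have hωderiv : ∀ b ∈ Ioo bm bp, HasDerivAt (ahWt τ w h y') (ωd b) b := fun b hb => by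
    have hτdiff : HasDerivAt τ (deriv τ b) b :=
      ((hτ.contDiffOn.differentiableOn one_ne_zero).differentiableAt (Ioo_mem_nhds hb.1 hb.2)).hasDerivAt
    have hlin : HasDerivAt (fun b : ℝ => 1 + w * h y' * b) (w * h y') b := by
      simpa using ((hasDerivAt_id b).const_mul (w * h y')).const_add 1
    have := hlin.mul hτdiff
    have hfun : ahWt τ w h y' = fun b => (1 + w * h y' * b) * τ b := by funext b'; rfl
    rw [hfun]
    refine this.congr_deriv ?_
    rw [hωd]; dsimp only
    rw [hτd, indicator_of_mem hb]
  have h1whb : ∀ b ∈ Icc bm bp, |1 + w * h y' * b| ≤ 3 / 2 := fun b hb => by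
    have := abs_le.mp ((abs_w_mul_h_mul_le hw0.le hH y' hb).trans hwH)
    rw [abs_le]; constructor <;> linarith [this.1, this.2]
  have hωb : ∀ b ∈ Icc bm bp, |ahWt τ w h y' b| ≤ 3 / 2 * Cτ := fun b hb => by
    unfold ahWt; rw [abs_mul]
    exact mul_le_mul (h1whb b hb) (hCτ b) (abs_nonneg _) (by norm_num)
  have hωdb : ∀ b ∈ Icc bm bp, |ωd b| ≤ w * H * Cτ + 3 / 2 * Cd := fun b hb => by
    rw [hωd]; dsimp only
    refine (abs_add_le _ _).trans (add_le_add ?_ ?_)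
    · rw [abs_mul, abs_mul, abs_of_pos hw0]
      exact mul_le_mul (mul_le_mul_of_nonneg_left (hH y') hw0.le) (hCτ b) (abs_nonneg _) (by positivity)
    · rw [abs_mul]
      exact mul_le_mul (h1whb b hb) (hτdb b) (abs_nonneg _) (by norm_num)
  obtain ⟨g, hg⟩ : ∃ g : ℝ → ℂ, g = fun b => ((ahWt τ w h y' b * p b : ℝ) : ℂ) := ⟨_, rfl⟩
  obtain ⟨g', hg'⟩ : ∃ g' : ℝ → ℂ, g' = fun b => ((ωd b * p b + ahWt τ w h y' b * p' b : ℝ) : ℂ) := ⟨_, rfl⟩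
  have hgm : Measurable g := by
    rw [hg]; exact Complex.measurable_ofReal.comp ((measurable_ahWt hτ w h y').mul hpc.measurable)
  have hg'm : Measurable g' := by
    rw [hg']
    exact Complex.measurable_ofReal.comp ((hωdm.mul hpc.measurable).add
      ((measurable_ahWt hτ w h y').mul hp'c.measurable))
  have hgc : ContinuousOn g (Icc bm bp) := by
    rw [hg]
    refine Complex.continuous_ofReal.comp_continuousOn (ContinuousOn.mul ?_ hpc.continuousOn)
    have : ahWt τ w h y' = fun b => (1 + w * h y' * b) * τ b := by funext b'; rfl
    rw [this]
    exact (by fun_prop : Continuous fun b : ℝ => 1 + w * h y' * b).continuousOn.mul hτ.continuousOn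
  have hgd : ∀ b ∈ Ioo bm bp, HasDerivAt g (g' b) b := fun b hb => by
    rw [hg, hg']
    exact ((hωderiv b hb).mul (hpd b)).ofReal_comp
  have hgb : ∀ b ∈ Icc bm bp, ‖g b‖ ≤ 3 * Cτ / (α₀ * w) := fun b hb => by
    rw [hg]; dsimp only
    rw [Complex.norm_real, Real.norm_eq_abs, abs_mul]
    calc |ahWt τ w h y' b| * |p b| ≤ 3 / 2 * Cτ * (2 / (α₀ * w)) :=
          mul_le_mul (hωb b hb) (hpb b hb) (abs_nonneg _) (by positivity)
      _ = 3 * Cτ / (α₀ * w) := by ring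
  have hαw : 0 < α₀ * w := mul_pos hα₀ hw0
  have hg'b : ∀ b, ‖g' b‖ ≤ (2 * H * Cτ + 3 * Cd + 9 * π / 4 * Cτ) / (α₀ * w) := fun b => by
    rw [hg']; dsimp only
    rw [Complex.norm_real, Real.norm_eq_abs]
    by_cases hb : b ∈ Icc bm bp
    · refine (abs_add_le _ _).trans ?_
      rw [abs_mul, abs_mul]
      have t1 : |ωd b| * |p b| ≤ (w * H * Cτ + 3 / 2 * Cd) * (2 / (α₀ * w)) :=
        mul_le_mul (hωdb b hb) (hpb b hb) (abs_nonneg _) (by positivity)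
      have t2 : |ahWt τ w h y' b| * |p' b| ≤ 3 / 2 * Cτ * (3 * π / (2 * α₀)) :=
        mul_le_mul (hωb b hb) (hp'b b hb) (abs_nonneg _) (by positivity)
      have e1 : (w * H * Cτ + 3 / 2 * Cd) * (2 / (α₀ * w)) = 2 * H * Cτ / α₀ + 3 * Cd / (α₀ * w) := by
        field_simp
      have e2 : 3 / 2 * Cτ * (3 * π / (2 * α₀)) = 9 * π / 4 * Cτ / α₀ := by ring
      have i1 : 2 * H * Cτ / α₀ ≤ 2 * H * Cτ / (α₀ * w) :=
        div_le_div_of_nonneg_left (by positivity) hαw (by nlinarith)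
      have i2 : 9 * π / 4 * Cτ / α₀ ≤ 9 * π / 4 * Cτ / (α₀ * w) :=
        div_le_div_of_nonneg_left (by positivity) hαw (by nlinarith)
      rw [e1] at t1; rw [e2] at t2
      have : 2 * H * Cτ / (α₀ * w) + 3 * Cd / (α₀ * w) + 9 * π / 4 * Cτ / (α₀ * w) =
          (2 * H * Cτ + 3 * Cd + 9 * π / 4 * Cτ) / (α₀ * w) := by ring
      linarith
    · have hω0 : ahWt τ w h y' b = 0 := ahWt_eq_zero hτ y' hb
      have hωd0 : ωd b = 0 := by
        rw [hωd]; dsimp only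
        rw [hτ.eq_zero b hb, hτd, indicator_of_notMem (fun h' => hb (Ioo_subset_Icc_self h')), mul_zero,
          mul_zero, add_zero]
      rw [hω0, hωd0, zero_mul, zero_mul, add_zero, abs_zero]
      positivity
  -- the phase derivative
  obtain ⟨D, hD⟩ : ∃ D : ℝ → ℝ, D = fun b => igC w * S2 / (π * pcP y' (igDelta w b)) := ⟨_, rfl⟩
  have hPc : Continuous fun b => pcP y' (igDelta w b) := by unfold pcP igDelta; fun_prop
  have hDm : Measurable D := by
    rw [hD]
    exact (continuous_const.div (continuous_const.mul hPc)
      fun b => (mul_pos Real.pi_pos (pcP_pos _ _)).ne').measurable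
  have hDd : ∀ b ∈ Icc bm bp, HasDerivAt (ahC w y') (D b) b := fun b hb => by
    rw [hD, hS2]; exact hasDerivAt_ahC hw0.le hπw1 ((hsm b hb).2.2.trans_lt (by norm_num))
  have hDb : ∀ b ∈ Icc bm bp, |D b| ≤ 4 * w := fun b hb => by
    have := ahStep_b_deriv_bounds hM0 hw0.le hwpc (hbM b hb) y'
    rw [← hS2] at this
    rw [hD]; dsimp only
    rw [abs_of_nonneg]
    · exact this.2
    · exact le_trans (by positivity) this.1
  have hDp : ∀ b, D b * p b = 1 := fun b => by
    rw [hD, hp]; dsimp only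
    have hP := pcP_pos y' (igDelta w b)
    field_simp
  -- `λ` as an oscillatory integral over `[b₋, b₊]`
  have hκ : (2 * π * (ξ : ℝ)) ≠ 0 := mul_ne_zero (by positivity) (by exact_mod_cast hξ)
  have hrepr : ahLam τ w h y' ξ =
      ∫ b in bm..bp, cexp (I * ((2 * π * (ξ : ℝ) : ℝ) : ℂ) * ahC w y' b) * (D b : ℂ) * g b := by
    unfold ahLam
    rw [← setIntegral_eq_integral_of_forall_compl_eq_zero (s := Icc bm bp) (fun b hb => by
      rw [ahWt_eq_zero hτ y' hb]; simp), integral_Icc_eq_integral_Ioc,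
      ← intervalIntegral.integral_of_le hτ.lt.le]
    refine intervalIntegral.integral_congr fun b _ => ?_
    rw [hg]; dsimp only
    rw [show (2 * π * I * ξ * ahC w y' b : ℂ) = I * ((2 * π * (ξ : ℝ) : ℝ) : ℂ) * ahC w y' b by
      push_cast; ring]
    have := hDp b
    push_cast
    rw [show cexp (I * (2 * π * ξ) * ahC w y' b) * (ahWt τ w h y' b : ℂ) =
      cexp (I * (2 * π * ξ) * ahC w y' b) * (ahWt τ w h y' b : ℂ) * ((D b * p b : ℝ) : ℂ) by
      rw [this]; push_cast; ring]
    push_cast; ring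
  rw [hrepr]
  have hmain := norm_integral_cexp_mul_deriv_mul_le hτ.lt.le hκ hDd hDm hDb hgc hgd hgm hg'm hgb hg'b
  refine hmain.trans ?_
  -- constants
  rw [abs_mul, abs_mul, abs_of_pos Real.pi_pos, abs_two, div_le_div_iff₀ (by positivity) (by positivity)]
  have hsum : 2 * (3 * Cτ / (α₀ * w)) + (bp - bm) * ((2 * H * Cτ + 3 * Cd + 9 * π / 4 * Cτ) / (α₀ * w)) =
      (K₀ - 1) / (α₀ * w) := by rw [hK₀]; field_simp; ring
  rw [hsum]
  rw [div_mul_eq_mul_div, div_le_iff₀ hαw]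
  have : K₀ / (2 * π * α₀) * (2 * π * |(ξ : ℝ)|) * (α₀ * w) = K₀ * (|(ξ : ℝ)| * w) := by
    field_simp
  rw [this]
  have hξw : 0 ≤ |(ξ : ℝ)| * w := by positivity
  nlinarith

end Decay

/-! ### The strict bound away from `ξ = 0` on good factors -/

section Strict

variable {τ : ℝ → ℝ} {bm bp : ℝ} {w : ℝ} {h : ℝ → ℝ} {H : ℝ}

/-- `sin x ≤ x - x³/9` on `[0, 1]` (from `|sin x - (x - x³/6)| ≤ (5/96)x⁴`). [folklore] -/
theorem sin_le_sub_cube_div {x : ℝ} (hx0 : 0 ≤ x) (hx1 : x ≤ 1) : Real.sin x ≤ x - x ^ 3 / 9 := by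
  have h := Real.sin_bound (show |x| ≤ 1 by rwa [abs_of_nonneg hx0])
  rw [abs_of_nonneg hx0] at h
  have h1 := (abs_le.mp h).2
  have hx4 : x ^ 4 ≤ x ^ 3 := by
    calc x ^ 4 = x ^ 3 * x := by ring
      _ ≤ x ^ 3 * 1 := mul_le_mul_of_nonneg_left hx1 (pow_nonneg hx0 3)
      _ = x ^ 3 := mul_one _
  nlinarith [pow_nonneg hx0 3]

/-- `|∫_{j}^{j+L} e^{itb} db| = L · |sin x|/x ≤ L(1 - x²/9)`, `x = |t|L/2 ∈ (0, 1]`: the Fourier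
transform of an interval is strictly smaller than its length. [folklore] -/
theorem norm_integral_cexp_interval_le {j L t : ℝ} (hL : 0 < L) (ht : t ≠ 0)
    (hx1 : |t| * L / 2 ≤ 1) :
    ‖∫ b in j..j + L, cexp (I * t * b)‖ ≤ L * (1 - (|t| * L / 2) ^ 2 / 9) := by
  have hIt : (I * t : ℂ) ≠ 0 := mul_ne_zero Complex.I_ne_zero (by exact_mod_cast ht)
  have hint : ∫ b in j..j + L, cexp (I * t * b) = (cexp (I * t * (j + L : ℝ)) - cexp (I * t * j)) / (I * t) := by
    have := integral_exp_mul_complex (a := j) (b := j + L) hIt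
    push_cast at this ⊢
    rw [← this]
  rw [hint, norm_div, norm_mul, Complex.norm_I, one_mul, Complex.norm_real, Real.norm_eq_abs]
  have hfac : cexp (I * t * ((j + L : ℝ) : ℂ)) - cexp (I * t * j) = cexp (I * t * j) * (cexp (I * ((t * L : ℝ) : ℂ)) - 1) := by
    rw [mul_sub, mul_one, ← Complex.exp_add]; congr 1; push_cast; ring
  rw [hfac, norm_mul, show (I * t * j : ℂ) = I * ((t * j : ℝ) : ℂ) by push_cast; ring,
    Complex.norm_exp_I_mul_ofReal, one_mul, Complex.norm_exp_I_mul_ofReal_sub_one]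
  -- `‖2 sin(tL/2)‖ = 2 sin x`, `x = |t| L/2 ∈ (0,1]`
  obtain ⟨x, hx⟩ : ∃ x : ℝ, x = |t| * L / 2 := ⟨_, rfl⟩
  rw [← hx] at hx1 ⊢
  have ht0 : 0 < |t| := abs_pos.mpr ht
  have hx0 : 0 < x := by rw [hx]; positivity
  have hsin : ‖2 * Real.sin (t * L / 2)‖ = 2 * Real.sin x := by
    have hsx : |Real.sin (t * L / 2)| = Real.sin x := by
      have h1 : |Real.sin (t * L / 2)| = |Real.sin x| := by
        rw [hx]
        rcases le_or_gt 0 t with h | h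
        · rw [abs_of_nonneg h]
        · rw [abs_of_neg h, show -t * L / 2 = -(t * L / 2) by ring, Real.sin_neg, abs_neg]
      rw [h1, abs_of_nonneg (Real.sin_nonneg_of_nonneg_of_le_pi hx0.le (hx1.trans (by linarith [Real.pi_gt_three])))]
    rw [Real.norm_eq_abs, abs_mul, abs_two, hsx]
  rw [hsin, div_le_iff₀ ht0]
  have hs := sin_le_sub_cube_div hx0.le hx1
  have hxt : 2 * x = |t| * L := by rw [hx]; ring
  calc 2 * Real.sin x ≤ 2 * (x - x ^ 3 / 9) := by linarith
    _ = (2 * x) * (1 - x ^ 2 / 9) := by ring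
    _ = L * (1 - x ^ 2 / 9) * |t| := by rw [hxt]; ring

/-- **The characteristic function of `τ` is uniformly `< 1` away from `0`**: if `τ ≥ ε₂` on a window
`[j₁, j₁ + L'] ⊆ [b₋, b₊]` then `|∫ e^{itb} τ(b) db| ≤ 1 - ε₂ L' x²/9`, `x = |t|L'/2 ≤ 1`
(`τ = ε₂ 1_{window} + ρ`, `ρ ≥ 0`, and the previous lemma). [cite: AjankiHuveneers2011, App. 7.3
("`|∫_J e^{izα_kb}τ(b)db| ≤ (1 - ε₃)∫_J τ`")] -/
theorem norm_charfun_tau_le (hτ : ReducedLawHyp τ bm bp) {j₁ L' ε₂ : ℝ} (hL' : 0 < L')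
    (hε₂ : 0 < ε₂) (hlow : ∀ b ∈ Icc j₁ (j₁ + L'), ε₂ ≤ τ b) {t : ℝ} (ht : t ≠ 0)
    (hx1 : |t| * L' / 2 ≤ 1) :
    ‖∫ b : ℝ, cexp (I * t * b) * (τ b : ℂ)‖ ≤ 1 - ε₂ * L' * (|t| * L' / 2) ^ 2 / 9 := by
  set J := Icc j₁ (j₁ + L') with hJ
  set ρ : ℝ → ℝ := fun b => τ b - ε₂ * J.indicator (fun _ => (1 : ℝ)) b with hρ
  have hρ0 : ∀ b, 0 ≤ ρ b := fun b => by
    simp only [hρ]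
    by_cases hb : b ∈ J
    · rw [indicator_of_mem hb, mul_one]; linarith [hlow b hb]
    · rw [indicator_of_notMem hb, mul_zero, sub_zero]; exact hτ.nonneg b
  have hind : Integrable (J.indicator fun _ => (1 : ℝ)) :=
    (integrable_indicator_iff measurableSet_Icc).mpr (integrableOn_const (hs := by
      rw [Real.volume_Icc]; exact ENNReal.ofReal_lt_top.ne))
  have hρi : Integrable ρ := hτ.integrable.sub (hind.const_mul _)
  have hem : ∀ f : ℝ → ℝ, Integrable f → Integrable fun b : ℝ => cexp (I * t * b) * (f b : ℂ) := fun f hf => by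
    refine (hf.ofReal (𝕜 := ℂ)).norm.mono' ?_ ?_
    · exact ((by fun_prop : Measurable fun b : ℝ => cexp (I * t * b)).aestronglyMeasurable.mul
        (hf.ofReal (𝕜 := ℂ)).1)
    · refine ae_of_all _ fun b => ?_
      rw [norm_mul, show (I * t * b : ℂ) = I * ((t * b : ℝ) : ℂ) by push_cast; ring,
        Complex.norm_exp_I_mul_ofReal, one_mul]
      exact le_rfl
  -- split `τ = ε₂ 1_J + ρ`
  have hsplit : ∫ b : ℝ, cexp (I * t * b) * (τ b : ℂ) =
      ε₂ * (∫ b in j₁..j₁ + L', cexp (I * t * b)) + ∫ b : ℝ, cexp (I * t * b) * (ρ b : ℂ) := by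
    have e1 : (fun b : ℝ => cexp (I * t * b) * (τ b : ℂ)) = fun b : ℝ =>
        (ε₂ : ℂ) * (cexp (I * t * b) * ((J.indicator (fun _ => (1 : ℝ)) b : ℝ) : ℂ)) +
        cexp (I * t * b) * (ρ b : ℂ) := by
      funext b; simp only [hρ]; push_cast; ring
    rw [e1, integral_add ((hem _ hind).const_mul _) (hem _ hρi), integral_const_mul]
    congr 2
    rw [intervalIntegral.integral_of_le (by linarith), ← integral_Icc_eq_integral_Ioc,
      ← integral_indicator measurableSet_Icc]
    refine integral_congr_ae (ae_of_all _ fun b => ?_)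
    dsimp only
    by_cases hb : b ∈ J
    · rw [hJ] at hb; rw [indicator_of_mem hb, indicator_of_mem hb]; push_cast; ring
    · rw [hJ] at hb; rw [indicator_of_notMem hb, indicator_of_notMem hb]; push_cast; ring
  rw [hsplit]
  have h1 := norm_integral_cexp_interval_le (j := j₁) hL' ht hx1
  have h2 : ‖∫ b : ℝ, cexp (I * t * b) * (ρ b : ℂ)‖ ≤ 1 - ε₂ * L' := by
    calc ‖∫ b : ℝ, cexp (I * t * b) * (ρ b : ℂ)‖ ≤ ∫ b : ℝ, ‖cexp (I * t * b) * (ρ b : ℂ)‖ :=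
          norm_integral_le_integral_norm _
      _ = ∫ b, ρ b := by
          refine integral_congr_ae (ae_of_all _ fun b => ?_)
          dsimp only
          rw [norm_mul, show (I * t * b : ℂ) = I * ((t * b : ℝ) : ℂ) by push_cast; ring,
            Complex.norm_exp_I_mul_ofReal, one_mul, Complex.norm_real, Real.norm_eq_abs, abs_of_nonneg (hρ0 b)]
      _ = 1 - ε₂ * L' := by
          simp only [hρ]
          rw [integral_sub hτ.integrable (hind.const_mul _), integral_const_mul, hτ.integral_eq_one,
            integral_indicator measurableSet_Icc, setIntegral_const, Real.volume_real_Icc_of_le (by linarith)]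
          simp
  calc ‖(ε₂ : ℂ) * (∫ b in j₁..j₁ + L', cexp (I * t * b)) + ∫ b : ℝ, cexp (I * t * b) * (ρ b : ℂ)‖
      ≤ ‖(ε₂ : ℂ) * ∫ b in j₁..j₁ + L', cexp (I * t * b)‖ + ‖∫ b : ℝ, cexp (I * t * b) * (ρ b : ℂ)‖ := norm_add_le _ _
    _ ≤ ε₂ * (L' * (1 - (|t| * L' / 2) ^ 2 / 9)) + (1 - ε₂ * L') := by
        refine add_le_add ?_ h2
        rw [norm_mul, Complex.norm_real, Real.norm_eq_abs, abs_of_pos hε₂]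
        exact mul_le_mul_of_nonneg_left h1 hε₂.le
    _ = 1 - ε₂ * L' * (|t| * L' / 2) ^ 2 / 9 := by ring
set_option maxHeartbeats 400000 in -- buildfix (bf3-g26): 160k/180k FAIL, 200k PASS at accept time; line-neutral budget line
/-- **Strict bound on good factors away from the origin**: for `sin²(πy') ≥ α₀ > 0` and `|ξ|w ≥ ε`,
`|λ(y', ξ)| ≤ A' < 1` for `w ≤ w₀` (`A'` depending on `τ, ‖h‖_∞, α₀, ε`). For `|ξ|w ≥ 2C₃` this is the
decay bound; on `[ε, 2C₃]` it is the strict characteristic-function bound for `τ` plus the `𝒪(w)`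
perturbations `c = wφb + 𝒪(w²)`, `ω = τ + 𝒪(w)` — the paper's "`|λ_k(z)| ≤ 1 - ε₁` for
`|z| ∈ [ε', 1/ε'[` and `k ∈ {k_j}`". [cite: AjankiHuveneers2011, App. 7.3 (`lemm interm 1`)] -/
theorem norm_ahLam_le_strict (hτ : ReducedLawHyp τ bm bp) (hH : ∀ z, |h z| ≤ H) {α₀ : ℝ} (hα₀ : 0 < α₀)
    {ε : ℝ} (hε : 0 < ε) :
    ∃ w₀ : ℝ, 0 < w₀ ∧ ∃ A' : ℝ, 0 < A' ∧ A' < 1 ∧ ∀ w ∈ Ioc 0 w₀, ∀ y' : ℝ, α₀ ≤ Real.sin (π * y') ^ 2 →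
      ∀ ξ : ℤ, ε ≤ |(ξ : ℝ)| * w → ‖ahLam τ w h y' ξ‖ ≤ A' := by
  obtain ⟨w₅, hw₅, C₃, hC₃, hdec⟩ := norm_ahLam_le_div hτ hH hα₀
  obtain ⟨w₁, hw₁, hw₁1, A₂, hA₂, hcest⟩ := ahC_estimates bm bp
  obtain ⟨j₁, j₂, ε₂, hj₁, hj₁₂, hj₂, hε₂, hlow⟩ := hτ.exists_lower_window
  obtain ⟨M, hM⟩ : ∃ M : ℝ, M = max |bm| |bp| := ⟨_, rfl⟩
  have hM0 : 0 ≤ M := hM ▸ le_max_of_le_left (abs_nonneg _)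
  have hH0 : 0 ≤ H := (abs_nonneg _).trans (hH 0)
  -- the window length and the gain
  obtain ⟨Z₀, hZ₀⟩ : ∃ Z₀ : ℝ, Z₀ = 2 * C₃ := ⟨_, rfl⟩
  have hZ₀0 : 0 < Z₀ := by rw [hZ₀]; positivity
  obtain ⟨L', hL'⟩ : ∃ L' : ℝ, L' = min (j₂ - j₁) (1 / (π * Z₀)) := ⟨_, rfl⟩
  have hL'0 : 0 < L' := by rw [hL']; exact lt_min (by linarith) (by positivity)
  have hL'le : L' ≤ j₂ - j₁ := hL' ▸ min_le_left _ _
  have hL'Z : L' ≤ 1 / (π * Z₀) := hL' ▸ min_le_right _ _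
  obtain ⟨δ₀, hδ₀⟩ : ∃ δ₀ : ℝ, δ₀ = ε₂ * L' * (π * ε * α₀ * L') ^ 2 / 18 := ⟨_, rfl⟩
  have hδ₀0 : 0 < δ₀ := by rw [hδ₀]; positivity
  obtain ⟨Cp, hCp⟩ : ∃ Cp : ℝ, Cp = 3 * π * A₂ * Z₀ + H * M := ⟨_, rfl⟩
  have hCp0 : 0 ≤ Cp := by rw [hCp]; positivity
  refine ⟨min w₅ (min w₁ (min (1 / (2 * H * M + 1)) (δ₀ / (Cp + 1)))), by positivity,
    max (1 - δ₀) (1 / 2), by positivity, max_lt (by linarith) (by norm_num), ?_⟩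
  intro w hw y' hα ξ hξ
  obtain ⟨hw0, hwle⟩ := hw
  have hw5 : w ∈ Ioc 0 w₅ := ⟨hw0, hwle.trans (min_le_left _ _)⟩
  have hww₁ : w ∈ Ioc 0 w₁ := ⟨hw0, hwle.trans ((min_le_right _ _).trans (min_le_left _ _))⟩
  have hwH : w * H * max |bm| |bp| ≤ 1 / 2 := by
    rw [← hM]
    have : w ≤ 1 / (2 * H * M + 1) :=
      hwle.trans ((min_le_right _ _).trans ((min_le_right _ _).trans (min_le_left _ _)))
    rw [le_div_iff₀ (by positivity)] at this
    nlinarith [mul_nonneg (mul_nonneg hw0.le hH0) hM0]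
  have hwδ : Cp * w ≤ δ₀ := by
    have : w ≤ δ₀ / (Cp + 1) :=
      hwle.trans ((min_le_right _ _).trans ((min_le_right _ _).trans (min_le_right _ _)))
    rw [le_div_iff₀ (by positivity)] at this
    nlinarith
  have hξ0 : ξ ≠ 0 := by
    rintro rfl; simp at hξ; linarith
  -- large `|ξ|w`: the decay bound
  by_cases hlarge : Z₀ ≤ |(ξ : ℝ)| * w
  · have := hdec w hw5 y' hα ξ hξ0
    refine this.trans ((div_le_iff₀ (by positivity)).mpr ?_ |>.trans (le_max_right _ _))
    rw [hZ₀] at hlarge; linarith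
  push Not at hlarge
  refine le_trans ?_ (le_max_left _ _)
  -- moderate `|ξ|w ∈ [ε, Z₀)`: compare with the characteristic function of `τ`
  obtain ⟨α, hαdef⟩ : ∃ α : ℝ, α = Real.sin (π * y') ^ 2 := ⟨_, rfl⟩
  rw [← hαdef] at hα
  have hαle : α ≤ 1 := hαdef ▸ Real.sin_sq_le_one _
  have hαpos : 0 < α := hα₀.trans_le hα
  obtain ⟨t, htdef⟩ : ∃ t : ℝ, t = 2 * π * ξ * w * α := ⟨_, rfl⟩
  have htabs : |t| = 2 * π * (|(ξ : ℝ)| * w) * α := by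
    rw [htdef, abs_mul, abs_mul, abs_mul, abs_mul, abs_of_pos Real.pi_pos, abs_two, abs_of_pos hw0,
      abs_of_pos hαpos]; ring
  have ht0 : t ≠ 0 := by
    rw [← abs_pos, htabs]; have : 0 < |(ξ : ℝ)| * w := hε.trans_le hξ; positivity
  have hx1 : |t| * L' / 2 ≤ 1 := by
    rw [htabs]
    have h1 : 2 * π * (|(ξ : ℝ)| * w) * α ≤ 2 * π * Z₀ * 1 := by gcongr
    calc 2 * π * (|(ξ : ℝ)| * w) * α * L' / 2 ≤ 2 * π * Z₀ * 1 * (1 / (π * Z₀)) / 2 := by gcongr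
      _ = 1 := by field_simp
  have hxge : π * ε * α₀ * L' ≤ |t| * L' / 2 := by
    rw [htabs]
    have : π * ε * α₀ ≤ π * (|(ξ : ℝ)| * w) * α := by gcongr
    nlinarith [hL'0]
  have hchar := norm_charfun_tau_le hτ hL'0 hε₂
    (fun b hb => hlow b ⟨hb.1, hb.2.trans (by linarith)⟩) ht0 hx1
  have hchar' : ‖∫ b : ℝ, cexp (I * t * b) * (τ b : ℂ)‖ ≤ 1 - 2 * δ₀ := by
    refine hchar.trans ?_
    rw [hδ₀]
    have : (π * ε * α₀ * L') ^ 2 ≤ (|t| * L' / 2) ^ 2 := pow_le_pow_left₀ (by positivity) hxge 2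
    nlinarith [mul_pos hε₂ hL'0]
  -- the perturbation `|λ - ∫ e^{itb} τ| ≤ Cp w`
  have hc : ∀ b ∈ Icc bm bp, |ahC w y' b - w * α * b| ≤ A₂ * w ^ 2 := fun b hb => by
    rw [hαdef]; exact (hcest w hww₁ y' b hb).1
  have hpert : ‖ahLam τ w h y' ξ - ∫ b : ℝ, cexp (I * t * b) * (τ b : ℂ)‖ ≤ Cp * w := by
    have iL := integrable_ahLam_integrand hτ w h y' ξ
    have iT : Integrable fun b : ℝ => cexp (I * t * b) * (τ b : ℂ) := by
      refine (hτ.integrable.ofReal (𝕜 := ℂ)).norm.mono' ((by fun_prop : Measurable fun b : ℝ => cexp (I * t * b)).mul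
        (Complex.measurable_ofReal.comp hτ.measurable)).aestronglyMeasurable (ae_of_all _ fun b => ?_)
      rw [norm_mul, show (I * t * b : ℂ) = I * ((t * b : ℝ) : ℂ) by push_cast; ring,
        Complex.norm_exp_I_mul_ofReal, one_mul]
      exact le_rfl
    unfold ahLam
    rw [← integral_sub iL iT]
    calc ‖∫ b : ℝ, (cexp (2 * π * I * ξ * ahC w y' b) * (ahWt τ w h y' b : ℂ) - cexp (I * t * b) * (τ b : ℂ))‖
        ≤ ∫ b : ℝ, ‖cexp (2 * π * I * ξ * ahC w y' b) * (ahWt τ w h y' b : ℂ) - cexp (I * t * b) * (τ b : ℂ)‖ :=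
          norm_integral_le_integral_norm _
      _ ≤ ∫ b, Cp * w * τ b := by
          refine integral_mono (iL.sub iT).norm (hτ.integrable.const_mul _) fun b => ?_
          by_cases hb : b ∈ Icc bm bp
          · -- `e₁ ω - e₂ τ = (e₁ - e₂) ω + e₂ (ω - τ)`
            have hωτ : (ahWt τ w h y' b : ℂ) - τ b = ((w * h y' * b * τ b : ℝ) : ℂ) := by
              unfold ahWt; push_cast; ring
            have e : cexp (2 * π * I * ξ * ahC w y' b) * (ahWt τ w h y' b : ℂ) - cexp (I * t * b) * (τ b : ℂ) =
                (cexp (2 * π * I * ξ * ahC w y' b) - cexp (I * t * b)) * (ahWt τ w h y' b : ℂ) +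
                cexp (I * t * b) * ((w * h y' * b * τ b : ℝ) : ℂ) := by
              rw [← hωτ]; ring
            rw [e]
            have hdiff : ‖cexp (2 * π * I * ξ * ahC w y' b) - cexp (I * t * b)‖ ≤ 2 * π * (|(ξ : ℝ)| * (A₂ * w ^ 2)) := by
              have hfac : cexp (2 * π * I * ξ * ahC w y' b) - cexp (I * t * b) =
                  cexp (I * t * b) * (cexp (I * ((2 * π * ξ * (ahC w y' b - w * α * b) : ℝ) : ℂ)) - 1) := by
                rw [mul_sub, mul_one, ← Complex.exp_add]; congr 1; rw [htdef]; push_cast; ring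
              rw [hfac, norm_mul, show (I * t * b : ℂ) = I * ((t * b : ℝ) : ℂ) by push_cast; ring,
                Complex.norm_exp_I_mul_ofReal, one_mul]
              refine (Real.norm_exp_I_mul_ofReal_sub_one_le).trans ?_
              rw [Real.norm_eq_abs, abs_mul, abs_mul, abs_mul, abs_of_pos Real.pi_pos, abs_two]
              calc 2 * π * |(ξ : ℝ)| * |ahC w y' b - w * α * b| = 2 * π * (|(ξ : ℝ)| * |ahC w y' b - w * α * b|) := by
                    ring
                _ ≤ 2 * π * (|(ξ : ℝ)| * (A₂ * w ^ 2)) :=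
                    mul_le_mul_of_nonneg_left (mul_le_mul_of_nonneg_left (hc b hb) (abs_nonneg _))
                      (by positivity)
            have hω0 : 0 ≤ ahWt τ w h y' b := ahWt_nonneg hτ hw0.le hH hwH y' b
            have hω32 : ahWt τ w h y' b ≤ 3 / 2 * τ b := ahWt_le hτ hw0.le hH hwH y' b
            calc ‖(cexp (2 * π * I * ξ * ahC w y' b) - cexp (I * t * b)) * (ahWt τ w h y' b : ℂ) +
                  cexp (I * t * b) * ((w * h y' * b * τ b : ℝ) : ℂ)‖
                ≤ ‖cexp (2 * π * I * ξ * ahC w y' b) - cexp (I * t * b)‖ * ahWt τ w h y' b + |w * h y' * b| * τ b := by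
                  refine (norm_add_le _ _).trans (add_le_add ?_ ?_)
                  · rw [norm_mul, Complex.norm_real, Real.norm_eq_abs, abs_of_nonneg hω0]
                  · rw [norm_mul, show (I * t * b : ℂ) = I * ((t * b : ℝ) : ℂ) by push_cast; ring,
                      Complex.norm_exp_I_mul_ofReal, one_mul, Complex.norm_real, Real.norm_eq_abs, abs_mul,
                      abs_of_nonneg (hτ.nonneg b)]
              _ ≤ 2 * π * (|(ξ : ℝ)| * (A₂ * w ^ 2)) * (3 / 2 * τ b) + (w * H * M) * τ b := by
                  refine add_le_add (mul_le_mul hdiff hω32 hω0 (by positivity))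
                    (mul_le_mul_of_nonneg_right (hM ▸ abs_w_mul_h_mul_le hw0.le hH y' hb) (hτ.nonneg b))
              _ = (3 * π * A₂ * (|(ξ : ℝ)| * w) + H * M) * w * τ b := by ring
              _ ≤ (3 * π * A₂ * Z₀ + H * M) * w * τ b := by
                  have : 3 * π * A₂ * (|(ξ : ℝ)| * w) ≤ 3 * π * A₂ * Z₀ := by gcongr
                  exact mul_le_mul_of_nonneg_right (mul_le_mul_of_nonneg_right (by linarith) hw0.le) (hτ.nonneg b)
              _ = Cp * w * τ b := by rw [hCp]
          · rw [ahWt_eq_zero hτ y' hb, hτ.eq_zero b hb]; simp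
      _ = Cp * w := by rw [integral_const_mul, hτ.integral_eq_one, mul_one]
  calc ‖ahLam τ w h y' ξ‖ = ‖(ahLam τ w h y' ξ - ∫ b : ℝ, cexp (I * t * b) * (τ b : ℂ)) + ∫ b : ℝ, cexp (I * t * b) * (τ b : ℂ)‖ := by
        rw [sub_add_cancel]
    _ ≤ Cp * w + (1 - 2 * δ₀) := (norm_add_le _ _).trans (add_le_add hpert hchar')
    _ ≤ 1 - δ₀ := by linarith

end Strict

end Literature.Barriers.AtomisticToContinuum.HeatConduction
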